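import Summits.QuantumFields.BalabanUV.Beta.GAN24.WilsonLetterFlatCharges

/-!
# `BalabanUV.Beta.GAN24.WilsonPairFormCharge` — binder row G-an2-4 ∕ (CONV-C), the (S) row of RULING R-gan24p1-g27-1 B (viii), road-P2's (W-γ) CHARGE TOWER
# (`W-GAMMA-TOWER-v0.md`, p2 g41) item §5 (b) «(I3)_0 for general block-constant potentials: leaf-02 (PART 6∕7 pencil is general in ψ …)», PART A:
# **THE CUBIC WILSON LETTER's TWO-LEG CHARGE AGAINST ANY PAIR OF EXACT WEIGHTS `dφ₁ ⊗ dφ₂` IS `−¼·d*d` OF THE PAIR FORM `m[φ₁,φ₂] = dzφ₂·(φ₁ + φ₁∘shift)` — EVERY pair of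
# potentials (g55 PART 6's pencil IS general in ψ); antisymmetric under the swap, zero for one potential on both legs; single-coordinate potentials `G_i(w_{a_i})`:
# same direction ≡ 0 per slot for ALL weights, cross direction = the weighted wedge `2ΔG₁(x_a)ΔG₂(x_b)·dx_a∧dx_b`, resummed against any ℓ¹ read-vector = minus the
# WEIGHTED plaquette curl; every weight on `ℤ` has a primitive; block-constant potentials give exactly the class-𝒟 weights `𝟙^{exit}·ΔF(blk)`**
# (G-an2-4 formalisation swarm → CRUX TEAM (2), seat `b2b-balaban-gan24-formalise-leaf-02`, gen 57; INTENT [LEAF02-G57-INTENT1], PART A of two)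

NOT IN PRINT; OUR BOOKKEEPING ([folklore] lattice calculus BY NAME: this seat's first-leg `dψ`-law `ContactOneGaugeCellAlgebra.tsum_dz_mul_wilsonA` (EVERY `ψ`), the Maxwell
contraction `ContactOneGaugeCellMaxwell.tsum_mul_curvAdj_curv_delta1`, g55's `WilsonLetterFaceCharge.curvAdj_curv_sub_smul`, `FaceChargeCurlResummation.curv_smul_fun_dz`,
`WilsonLetterFlatCharges.sum_sum_curv_mul_wedge ∕ tsum_sum_mul_eq_neg_tsum_of_quarter ∕ curv_axialForm_eq_zero`, `SymLinKernelFaceSupport.int_ediv_add_one`, an2's `AffineAveraging.curv_dz`;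
0 `def`, 0 cited fact, 0 `def … : Prop`, 0 sorry).  leaf-06 g47's `CombFreeGaugeLegCharges.wilsonA_gaugeLeg_charge` (staged, `n ⊗ dψ` for ANY 1-form `n`) is the one-exact-leg
generalisation; at `n := dzφ₁` it gives the same value (`¼·d*d(σ_{φ₂} ⊙ dzφ₁) = −¼·d*d m[φ₁,φ₂]` by `pairForm_add_pairForm_swap`); nothing of that file is imported or restated here.
HONEST FRAMING (cell contract, verbatim): «discharging `BetaPertH` makes Bałaban's UV stability UNCONDITIONAL — a real constructive-QFT result; it is NOT the continuum limit and
NOT the Clay problem.»  HONEST DEPENDENCY (verbatim): «continuum YM on T⁴ ⇐ BetaPertH ∧ nine spine estimates (0/9 proved); BetaPertH ⇐ (D1) ∧ (D4) ∧ CAP+tail; G-an2-4 gates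
asym, D1 and NE2/3/4.»

WHY.  Road-P2's tower propagates (I3)_j «the two-leg ff charge of the level-`j` step table against class-𝒟 weights `f_i((blk x)_{a_i})·𝟙^{exit}_{a_i}(x)` is `Δ_j`-exact» upward
((I1) `ChargeTowerStep.hasSum_prod_coordWeighted_SpureRecAt_succ_inl_inl`: the level-`(j+1)` charge is the `ℋ`-column read of the level-`j` charge against PULLED-BACK class-𝒟 weights
`cH_j·f(⌊·∕Lc⌋)·exit`).  The base (I3)_0 was typed only for the pure exit indicators (`f ≡ 1`: g55 PART 6, g56 PART 2).  Every class-𝒟 weight is an EXACT form with a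
block-constant coordinate potential, `𝟙^{exit}_a(x)·ΔF((blk x)_a) = (dz (F ∘ (⌊·_a∕L⌋))) a x` (`blockPot_forwardDiff`), so the Wilson share of (I3)_0 is the `φ_i = F_i∘⌊·_{a_i}∕L⌋`
instance of ONE identity for arbitrary potentials — §1 — which also covers p2's E28 (B) «1F ∕ exit ∕ exit² ∕ entry ∕ slab channels all `Δ₀`-exact at jb = 0» for the
Wilson letter (every single-coordinate weight is `ΔG(x_a)` for some `G`, `exists_forwardDiff_eq`).  PART B (`SrecChargeBlockPotentials`) adds the Λ-letter and the END.

WHAT (generic `d`, `ℤ^{d+1}`; `W = StepJetData.wilsonA d`, slot `(κ′,u)`, fluctuation legs `(α,x)`, `(β,z)`; the PAIR FORM `m[φ₁,φ₂] β z := dzφ₂ β z·(φ₁ z + φ₁(z + e_β))`, a lambda).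
* §1 **`tsum_sum_dz_mul_tsum_sum_dz_mul_wilsonA`** — for EVERY `φ₁ φ₂`: `Σ'_z Σ_β dzφ₂ β z·(Σ'_x Σ_α dzφ₁ α x·W κ′ u x z (inl α)(inl β)) = −¼·(d*d m[φ₁,φ₂])_{κ′}(u)`
  (the `u`-dependent slot term `½φ₁(u+e_κ′)•dzφ₂` dies by `d∘d = 0`); `pairForm_add_pairForm_swap` (`m[φ₁,φ₂] + m[φ₂,φ₁] = 2•dz(φ₁φ₂)`), **`curvAdj_curv_pairForm_swap`**
  (ANTISYMMETRY under the swap of the two potentials), **`…_wilsonA_self`** (`φ₁ = φ₂` ⇒ `0` at every slot).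
* §2 SINGLE-COORDINATE POTENTIALS `φ_i w = G_i(w_{a_i})` (ANY `G_i : ℤ → ℝ`): `dz_coordPot`, `sum_dz_coordPot_mul`; **`tsum_coordWt_tsum_coordWt_wilsonA`** (single-channel form:
  `Σ'_z ΔG₂(z_b)·Σ'_x ΔG₁(x_a)·W κ′ u x z (inl a)(inl b) = −¼·(d*d m)_{κ′}(u)`); `curvAdj_curv_pairForm_coord_same` + **`…_wilsonA_same`** (`a = b` ⇒ `0` for EVERY `G₁ G₂`);
  `curv_pairForm_coord_dz` (Leibniz form), `dz_coordPot_mul_dz_coordPot_shift`, **`curv_pairForm_coord`** (`a ≠ b`: `curv m κ l x = 2·(ΔG₁(x_a)ΔG₂(x_b))·([κ=a][l=b] − [l=a][κ=b])`),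
  `abs_curv_pairForm_coord_le`, **`tsum_sum_mul_coordCharge_wilsonA_eq_neg_tsum`** (bounded `ΔG_i`, `r` ℓ¹: `Σ'_u Σ_κ′ r κ′ u·C(κ′,u) = −Σ'_x ΔG₁(x_a)ΔG₂(x_b)·(curv r) a b x`);
  `exists_forwardDiff_eq` (every `f : ℤ → ℝ` is `ΔF`), `blockPot_forwardDiff` (`G = F∘(⌊·∕L⌋)` ⇒ `ΔG(t) = 𝟙[t % L = L−1]·ΔF(⌊t∕L⌋)` — class 𝒟; PART 6 ∕ 7 ∕ 7b are `F = id`, `G = id`).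
Asserts NO value of any resolvent column or read vector; the bounded ∕ periodic ∕ hard-axial REPRESENTATIVE of `m` (leaf-06's `EdgePlaquettePotential` business) is NOT supplied;
NOTHING of (W-γ) ∕ (INV) ∕ (S) ∕ (Q-R) ∕ (DL) ∕ «T2Shape» ∕ (hW, hWall) discharged; NEVER «G-an2-4 closed» as (CONV-C); NOT D1, NOT `BetaPertH`, NOT continuum, NOT Clay.  2026-08-22;
no existing file touched.
-/

noncomputable section

open Finset
open scoped BigOperators
open Literature.MathematicalPhysics.QuantumFieldTheory
open Literature.MathematicalPhysics.QuantumFieldTheory.Balaban1983to89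
open Literature.MathematicalPhysics.QuantumFieldTheory.Balaban1983to89.Beta
open AffineAveraging (Form1 Form2 unitVec unitVec_apply dz curv curvAdj curv_dz)
open StepJetData (wilsonA)
open KKTFluctuationKernel (delta1)
open Summit.QuantumFields.BalabanUV.Beta.GAN24.ContactOneGaugeCellAlgebra (tsum_dz_mul_wilsonA affine_unitVec_eq)
open Summit.QuantumFields.BalabanUV.Beta.GAN24.ContactOneGaugeCellMaxwell (tsum_mul_curvAdj_curv_delta1)
open Summit.QuantumFields.BalabanUV.Beta.GAN24.WilsonLetterFaceCharge (curvAdj_curv_sub_smul)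
open Summit.QuantumFields.BalabanUV.Beta.GAN24.FaceChargeCurlResummation (curv_smul_fun_dz)
open Summit.QuantumFields.BalabanUV.Beta.GAN24.WilsonLetterFlatCharges (sum_sum_curv_mul_wedge tsum_sum_mul_eq_neg_tsum_of_quarter curv_axialForm_eq_zero)
open Summit.QuantumFields.BalabanUV.Beta.GAN24.SymLinKernelFaceSupport (int_ediv_add_one)

namespace Summit.QuantumFields.BalabanUV.Beta.GAN24.WilsonPairFormCharge

variable {d : ℕ}

/-! ## §1 The Wilson letter against two exact weights: every pair of potentials -/

/-- NOT IN PRINT; OUR BOOKKEEPING.  **THE CUBIC WILSON LETTER's TWO-LEG CHARGE AGAINST `dφ₁ ⊗ dφ₂`, EVERY PAIR OF POTENTIALS, EVERY SLOT**: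
`Σ'_z Σ_β dzφ₂ β z·(Σ'_x Σ_α dzφ₁ α x·W κ′ u x z (inl α)(inl β)) = −¼·(d*d m[φ₁,φ₂])_{κ′}(u)` with the pair form `m[φ₁,φ₂] β z = dzφ₂ β z·(φ₁ z + φ₁(z+e_β))` — the first-leg
`dψ`-law at `ψ = φ₁`, the Maxwell contraction in the second leg, and `d(dzφ₂) = 0` killing the slot term `½φ₁(u+e_κ′)•dzφ₂` (g55 PART 6 with the coarse coordinates replaced
by arbitrary potentials). -/
theorem tsum_sum_dz_mul_tsum_sum_dz_mul_wilsonA (φ₁ φ₂ : (Fin (d + 1) → ℤ) → ℝ) (κ' : Fin (d + 1)) (u : Fin (d + 1) → ℤ) :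
    ∑' z, ∑ β, dz φ₂ β z * ∑' x, ∑ α, dz φ₁ α x * wilsonA d κ' u x z (Sum.inl α) (Sum.inl β)
      = -(1 / 4 : ℝ) * curvAdj (curv (fun β z => dz φ₂ β z * (φ₁ z + φ₁ (z + B6BondElimination.unitVec β)))) κ' u := by
  have hin : ∀ (z : Fin (d + 1) → ℤ) (β : Fin (d + 1)), ∑' x, ∑ α, dz φ₁ α x * wilsonA d κ' u x z (Sum.inl α) (Sum.inl β)
      = (1 / 2 : ℝ) * (φ₁ (u + B6BondElimination.unitVec κ') - (φ₁ z + φ₁ (z + B6BondElimination.unitVec β)) / 2)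
        * curvAdj (curv (delta1 κ' u)) β z := fun z β => tsum_dz_mul_wilsonA κ' u z β φ₁
  simp only [hin]
  set cu : ℝ := φ₁ (u + B6BondElimination.unitVec κ') with hcu
  have e : ∀ z : Fin (d + 1) → ℤ, ∑ β, dz φ₂ β z * ((1 / 2 : ℝ) * (cu - (φ₁ z + φ₁ (z + B6BondElimination.unitVec β)) / 2) * curvAdj (curv (delta1 κ' u)) β z)
      = ∑ β, ((cu / 2) * dz φ₂ β z - (1 / 4 : ℝ) * (dz φ₂ β z * (φ₁ z + φ₁ (z + B6BondElimination.unitVec β))))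
          * curvAdj (curv (delta1 κ' u)) β z := by
    intro z
    refine Finset.sum_congr rfl fun β _ => ?_
    ring
  rw [tsum_congr e, tsum_mul_curvAdj_curv_delta1 (fun β z => (cu / 2) * dz φ₂ β z
    - (1 / 4 : ℝ) * (dz φ₂ β z * (φ₁ z + φ₁ (z + B6BondElimination.unitVec β)))) κ' u, curvAdj_curv_sub_smul]
  have h0 : curvAdj (curv (dz φ₂)) κ' u = 0 := by
    rw [curv_dz]
    simp [AffineAveraging.curvAdj]
  rw [h0]
  ring

/-- [folklore] **THE TWO PAIR FORMS OF A PAIR OF POTENTIALS ADD UP TO AN EXACT FORM**: `m[φ₁,φ₂] + m[φ₂,φ₁] = 2•dz(φ₁·φ₂)` (pointwise ring identity). -/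
theorem pairForm_add_pairForm_swap (φ₁ φ₂ : (Fin (d + 1) → ℤ) → ℝ) :
    ((fun β z => dz φ₂ β z * (φ₁ z + φ₁ (z + B6BondElimination.unitVec β))) + fun β z => dz φ₁ β z * (φ₂ z + φ₂ (z + B6BondElimination.unitVec β)))
      = fun β z => 2 * dz (fun w => φ₁ w * φ₂ w) β z := by
  funext β z
  simp only [Pi.add_apply, AffineAveraging.dz, affine_unitVec_eq]
  ring

/-- NOT IN PRINT; OUR BOOKKEEPING.  **THE CHARGE IS ANTISYMMETRIC UNDER THE SWAP OF THE TWO POTENTIALS**: `d*d m[φ₂,φ₁] = −d*d m[φ₁,φ₂]` (their sum is `2•dz(φ₁φ₂)`, `d∘d = 0`). -/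
theorem curvAdj_curv_pairForm_swap (φ₁ φ₂ : (Fin (d + 1) → ℤ) → ℝ) (κ' : Fin (d + 1)) (u : Fin (d + 1) → ℤ) :
    curvAdj (curv (fun β z => dz φ₁ β z * (φ₂ z + φ₂ (z + B6BondElimination.unitVec β)))) κ' u
      = -curvAdj (curv (fun β z => dz φ₂ β z * (φ₁ z + φ₁ (z + B6BondElimination.unitVec β)))) κ' u := by
  have hsum := pairForm_add_pairForm_swap (d := d) φ₁ φ₂
  have e : (fun β z => dz φ₁ β z * (φ₂ z + φ₂ (z + B6BondElimination.unitVec β)))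
      = fun β z => (2 : ℝ) * dz (fun w => φ₁ w * φ₂ w) β z - (1 : ℝ) * (dz φ₂ β z * (φ₁ z + φ₁ (z + B6BondElimination.unitVec β))) := by
    funext β z
    have h := congrFun (congrFun hsum β) z
    simp only [Pi.add_apply] at h
    linarith
  rw [e, curvAdj_curv_sub_smul]
  have h0 : curvAdj (curv (dz (fun w : Fin (d + 1) → ℤ => φ₁ w * φ₂ w))) κ' u = 0 := by
    rw [curv_dz]
    simp [AffineAveraging.curvAdj]
  rw [h0]
  ring

/-- NOT IN PRINT; OUR BOOKKEEPING.  **ONE POTENTIAL ON BOTH LEGS ⇒ NO CHARGE AT ANY SLOT**: `m[λ,λ] = dz(λ²)` is exact, so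
`Σ'_z Σ_β dzλ β z·(Σ'_x Σ_α dzλ α x·W κ′ u x z (inl α)(inl β)) = 0`. -/
theorem tsum_sum_dz_mul_tsum_sum_dz_mul_wilsonA_self (φ₁ : (Fin (d + 1) → ℤ) → ℝ) (κ' : Fin (d + 1)) (u : Fin (d + 1) → ℤ) :
    ∑' z, ∑ β, dz φ₁ β z * ∑' x, ∑ α, dz φ₁ α x * wilsonA d κ' u x z (Sum.inl α) (Sum.inl β) = 0 := by
  rw [tsum_sum_dz_mul_tsum_sum_dz_mul_wilsonA]
  have e : (fun β z => dz φ₁ β z * (φ₁ z + φ₁ (z + B6BondElimination.unitVec β))) = dz (fun w => φ₁ w * φ₁ w) := by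
    funext β z
    simp only [AffineAveraging.dz, affine_unitVec_eq]
    ring
  rw [e, curv_dz]
  simp [AffineAveraging.curvAdj]

/-! ## §2 Single-coordinate potentials `λ w = G(w_a)`: single-channel form, same direction, the weighted wedge, resummation -/

/-- [folklore] The differential of a single-coordinate potential lives on its own axis: `dz (G∘(·)_a) α x = [α = a]·(G(x_a + 1) − G(x_a))`. -/
theorem dz_coordPot (G : ℤ → ℝ) (a α : Fin (d + 1)) (x : Fin (d + 1) → ℤ) :
    dz (fun w : Fin (d + 1) → ℤ => G (w a)) α x = if α = a then G (x a + 1) - G (x a) else 0 := by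
  simp only [AffineAveraging.dz, Pi.add_apply, unitVec_apply]
  by_cases h : α = a
  · rw [if_pos h, h, if_pos rfl]
  · rw [if_neg (fun h' => h h'.symm), if_neg h, add_zero, sub_self]

/-- [folklore] A direction sum against the differential of a single-coordinate potential collapses to the potential's channel. -/
theorem sum_dz_coordPot_mul (G : ℤ → ℝ) (a : Fin (d + 1)) (x : Fin (d + 1) → ℤ) (T : Fin (d + 1) → ℝ) :
    ∑ α, dz (fun w : Fin (d + 1) → ℤ => G (w a)) α x * T α = (G (x a + 1) - G (x a)) * T a := by
  simp only [dz_coordPot, ite_mul, zero_mul, Finset.sum_ite_eq', Finset.mem_univ, if_true]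

/-- NOT IN PRINT; OUR BOOKKEEPING.  **THE SINGLE-CHANNEL FORM** (ANY `G₁ G₂ : ℤ → ℝ`, channel `(a,b)`, weights `ΔG₁(x_a)`, `ΔG₂(z_b)`):
`Σ'_z ΔG₂(z_b)·Σ'_x ΔG₁(x_a)·W κ′ u x z (inl a)(inl b) = −¼·(d*d m)_{κ′}(u)`, `m β z = dz(G₂∘(·)_b) β z·(G₁(z_a) + G₁((z+e_β)_a))` — every single-coordinate weight pair (plain, exit, slab,
entry, weighted exits …) gives a lattice Maxwell image read at the slot. -/
theorem tsum_coordWt_tsum_coordWt_wilsonA (G₁ G₂ : ℤ → ℝ) (κ' : Fin (d + 1)) (u : Fin (d + 1) → ℤ) (a b : Fin (d + 1)) :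
    ∑' z, (G₂ (z b + 1) - G₂ (z b)) * ∑' x, (G₁ (x a + 1) - G₁ (x a)) * wilsonA d κ' u x z (Sum.inl a) (Sum.inl b)
      = -(1 / 4 : ℝ) * curvAdj (curv (fun β z => dz (fun w : Fin (d + 1) → ℤ => G₂ (w b)) β z
          * (G₁ (z a) + G₁ ((z + B6BondElimination.unitVec β) a)))) κ' u := by
  have h := tsum_sum_dz_mul_tsum_sum_dz_mul_wilsonA (fun w : Fin (d + 1) → ℤ => G₁ (w a)) (fun w : Fin (d + 1) → ℤ => G₂ (w b)) κ' u
  simp only [sum_dz_coordPot_mul] at h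
  exact h

/-- [folklore] **SAME DIRECTION: THE PAIR FORM OF TWO SINGLE-COORDINATE POTENTIALS ON ONE AXIS IS CLOSED** (`a = b`): it is `[β = a]·q(z_a)`, a form on the `a`-axis depending
on `z_a` only (g55's `curv_axialForm_eq_zero`), so its `d*d` vanishes identically. -/
theorem curvAdj_curv_pairForm_coord_same (G₁ G₂ : ℤ → ℝ) (a κ' : Fin (d + 1)) (u : Fin (d + 1) → ℤ) :
    curvAdj (curv (fun β z => dz (fun w : Fin (d + 1) → ℤ => G₂ (w a)) β z * (G₁ (z a) + G₁ ((z + B6BondElimination.unitVec β) a)))) κ' u = 0 := by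
  have e : (fun β z => dz (fun w : Fin (d + 1) → ℤ => G₂ (w a)) β z * (G₁ (z a) + G₁ ((z + B6BondElimination.unitVec β) a)))
      = fun β (z : Fin (d + 1) → ℤ) => (if β = a then (1 : ℝ) else 0) * ((G₂ (z a + 1) - G₂ (z a)) * (G₁ (z a) + G₁ (z a + 1))) := by
    funext β z
    rw [dz_coordPot, Pi.add_apply, B6BondElimination.unitVec_apply]
    by_cases h : β = a
    · rw [if_pos h, if_pos h.symm, if_pos h, one_mul]
    · rw [if_neg h, if_neg h, zero_mul, zero_mul]
  rw [e]
  have hc : curv (fun β (z : Fin (d + 1) → ℤ) => (if β = a then (1 : ℝ) else 0) * ((G₂ (z a + 1) - G₂ (z a)) * (G₁ (z a) + G₁ (z a + 1)))) = 0 := by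
    funext κ l x
    exact curv_axialForm_eq_zero a (fun t => (G₂ (t + 1) - G₂ t) * (G₁ t + G₁ (t + 1))) κ l x
  rw [hc]
  simp [AffineAveraging.curvAdj]

/-- NOT IN PRINT; OUR BOOKKEEPING.  **SAME DIRECTION ⇒ NO CHARGE AT ANY SLOT, FOR EVERY PAIR OF SINGLE-COORDINATE POTENTIALS** (`a = b`; p2's E26g∕E28 «same-direction channels ≡ 0»,
now for ALL single-coordinate weights — plain, exit, slab, entry, weighted). -/
theorem tsum_coordWt_tsum_coordWt_wilsonA_same (G₁ G₂ : ℤ → ℝ) (κ' : Fin (d + 1)) (u : Fin (d + 1) → ℤ) (a : Fin (d + 1)) :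
    ∑' z, (G₂ (z a + 1) - G₂ (z a)) * ∑' x, (G₁ (x a + 1) - G₁ (x a)) * wilsonA d κ' u x z (Sum.inl a) (Sum.inl a) = 0 := by
  rw [tsum_coordWt_tsum_coordWt_wilsonA, curvAdj_curv_pairForm_coord_same, mul_zero]

/-- NOT IN PRINT; OUR BOOKKEEPING.  **THE CURVATURE OF THE PAIR FORM OF TWO SINGLE-COORDINATE POTENTIALS, LEIBNIZ FORM** (`a ≠ b`): on the `b`-bonds `(z+e_b)_a = z_a`, so
`m = (2G₁∘(·)_a)•dz(G₂∘(·)_b)` and `curv m κ l x = 2·(dz(G₁∘(·)_a) κ x·dz(G₂∘(·)_b) l (x+e_κ) − dz(G₁∘(·)_a) l x·dz(G₂∘(·)_b) κ (x+e_l))` (Leibniz + `dd = 0`, g55 PART 7's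
`curv_smul_fun_dz`; PART 7's `curv_faceForm` is `G_i = ⌊·∕L⌋`). -/
theorem curv_pairForm_coord_dz (G₁ G₂ : ℤ → ℝ) {a b : Fin (d + 1)} (hab : a ≠ b) (κ l : Fin (d + 1)) (x : Fin (d + 1) → ℤ) :
    curv (fun β z => dz (fun w : Fin (d + 1) → ℤ => G₂ (w b)) β z * (G₁ (z a) + G₁ ((z + B6BondElimination.unitVec β) a))) κ l x
      = 2 * (dz (fun w : Fin (d + 1) → ℤ => G₁ (w a)) κ x * dz (fun w : Fin (d + 1) → ℤ => G₂ (w b)) l (x + unitVec κ)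
          - dz (fun w : Fin (d + 1) → ℤ => G₁ (w a)) l x * dz (fun w : Fin (d + 1) → ℤ => G₂ (w b)) κ (x + unitVec l)) := by
  have e : (fun β z => dz (fun w : Fin (d + 1) → ℤ => G₂ (w b)) β z * (G₁ (z a) + G₁ ((z + B6BondElimination.unitVec β) a)))
      = fun β z => (fun y : Fin (d + 1) → ℤ => 2 * G₁ (y a)) z * dz (fun w : Fin (d + 1) → ℤ => G₂ (w b)) β z := by
    funext β z
    rw [dz_coordPot]
    by_cases h : β = b
    · have : (z + B6BondElimination.unitVec β) a = z a := by
        rw [Pi.add_apply, B6BondElimination.unitVec_apply, if_neg (fun h' => hab (h'.trans h)), add_zero]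
      rw [this, if_pos h]
      ring
    · rw [if_neg h, zero_mul, mul_zero]
  rw [e, curv_smul_fun_dz]
  have hd : ∀ (μ : Fin (d + 1)) (y : Fin (d + 1) → ℤ), dz (fun z : Fin (d + 1) → ℤ => 2 * G₁ (z a)) μ y
      = 2 * dz (fun w : Fin (d + 1) → ℤ => G₁ (w a)) μ y := by
    intro μ y
    simp only [AffineAveraging.dz]
    ring
  rw [hd, hd]
  ring

/-- [folklore] One term of the Leibniz form in indicator shape: `dz(G₁∘(·)_a) κ x·dz(G₂∘(·)_b) l (x+e_κ) = [κ=a]·[l=b]·(ΔG₁(x_a)·ΔG₂(x_b))` (`a ≠ b`: when `κ = a`, `(x+e_a)_b = x_b`). -/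
theorem dz_coordPot_mul_dz_coordPot_shift (G₁ G₂ : ℤ → ℝ) {a b : Fin (d + 1)} (hab : a ≠ b) (κ l : Fin (d + 1)) (x : Fin (d + 1) → ℤ) :
    dz (fun w : Fin (d + 1) → ℤ => G₁ (w a)) κ x * dz (fun w : Fin (d + 1) → ℤ => G₂ (w b)) l (x + unitVec κ)
      = (if κ = a then (1 : ℝ) else 0) * (if l = b then (1 : ℝ) else 0) * ((G₁ (x a + 1) - G₁ (x a)) * (G₂ (x b + 1) - G₂ (x b))) := by
  rw [dz_coordPot, dz_coordPot]
  by_cases hκ : κ = a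
  · have hxb : (x + unitVec κ) b = x b := by
      rw [Pi.add_apply, unitVec_apply, if_neg (fun h' => hab (h'.trans hκ).symm), add_zero]
    rw [if_pos hκ, if_pos hκ, hxb]
    by_cases hl : l = b
    · rw [if_pos hl, if_pos hl]
      ring
    · rw [if_neg hl, if_neg hl]
      ring
  · rw [if_neg hκ, if_neg hκ]
    ring

/-- NOT IN PRINT; OUR BOOKKEEPING.  **THE CURVATURE OF THE PAIR FORM IS THE WEIGHTED WEDGE** (`a ≠ b`):
`curv m κ l x = 2·(ΔG₁(x_a)·ΔG₂(x_b))·([κ=a][l=b] − [l=a][κ=b])` — supported on the `(a,b)`-plaquettes where both weights are alive (g55 PART 7b's `curv_mixForm` ∕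
PART 7's edge plaquettes are the instances `G = id`, `G = ⌊·∕L⌋`). -/
theorem curv_pairForm_coord (G₁ G₂ : ℤ → ℝ) {a b : Fin (d + 1)} (hab : a ≠ b) (κ l : Fin (d + 1)) (x : Fin (d + 1) → ℤ) :
    curv (fun β z => dz (fun w : Fin (d + 1) → ℤ => G₂ (w b)) β z * (G₁ (z a) + G₁ ((z + B6BondElimination.unitVec β) a))) κ l x
      = 2 * ((G₁ (x a + 1) - G₁ (x a)) * (G₂ (x b + 1) - G₂ (x b)))
          * ((if κ = a then (1 : ℝ) else 0) * (if l = b then (1 : ℝ) else 0) - (if l = a then (1 : ℝ) else 0) * (if κ = b then (1 : ℝ) else 0)) := by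
  rw [curv_pairForm_coord_dz G₁ G₂ hab, dz_coordPot_mul_dz_coordPot_shift G₁ G₂ hab κ l x, dz_coordPot_mul_dz_coordPot_shift G₁ G₂ hab l κ x]
  ring

/-- [folklore] The weighted wedge is bounded: `|curv m κ l x| ≤ 2·(2B₁)·(2B₂)` when `|G_i| ≤ B_i` … stated with the bounds on the DIFFERENCES: `|ΔG_i| ≤ D_i` ⇒ `|curv m| ≤ 2·D₁·D₂`. -/
theorem abs_curv_pairForm_coord_le (G₁ G₂ : ℤ → ℝ) {a b : Fin (d + 1)} (hab : a ≠ b) {D₁ D₂ : ℝ} (h₁ : ∀ t, |G₁ (t + 1) - G₁ t| ≤ D₁)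
    (h₂ : ∀ t, |G₂ (t + 1) - G₂ t| ≤ D₂) (κ l : Fin (d + 1)) (x : Fin (d + 1) → ℤ) :
    |curv (fun β z => dz (fun w : Fin (d + 1) → ℤ => G₂ (w b)) β z * (G₁ (z a) + G₁ ((z + B6BondElimination.unitVec β) a))) κ l x| ≤ 2 * D₁ * D₂ := by
  rw [curv_pairForm_coord G₁ G₂ hab]
  have hD₁ : 0 ≤ D₁ := (abs_nonneg _).trans (h₁ 0)
  have hD₂ : 0 ≤ D₂ := (abs_nonneg _).trans (h₂ 0)
  have hw : |((if κ = a then (1 : ℝ) else 0) * (if l = b then (1 : ℝ) else 0) - (if l = a then (1 : ℝ) else 0) * (if κ = b then (1 : ℝ) else 0))| ≤ 1 := by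
    split_ifs <;> norm_num
  have hP : |(G₁ (x a + 1) - G₁ (x a)) * (G₂ (x b + 1) - G₂ (x b))| ≤ D₁ * D₂ := by
    rw [abs_mul]
    exact mul_le_mul (h₁ _) (h₂ _) (abs_nonneg _) hD₁
  rw [abs_mul, abs_mul, abs_two]
  nlinarith [hP, hw, abs_nonneg ((G₁ (x a + 1) - G₁ (x a)) * (G₂ (x b + 1) - G₂ (x b))),
    abs_nonneg (((if κ = a then (1 : ℝ) else 0) * (if l = b then (1 : ℝ) else 0) - (if l = a then (1 : ℝ) else 0) * (if κ = b then (1 : ℝ) else 0))),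
    mul_nonneg hD₁ hD₂]

/-- NOT IN PRINT; OUR BOOKKEEPING.  **RESUMMATION AGAINST AN ℓ¹ READ-VECTOR = MINUS THE WEIGHTED PLAQUETTE CURL** (`a ≠ b`, bounded differences, `∀ κ, Summable |r κ ·|`):
`Σ'_u Σ_κ′ r κ′ u·[Σ'_z ΔG₂(z_b)·Σ'_x ΔG₁(x_a)·W κ′ u x z (inl a)(inl b)] = −Σ'_x ΔG₁(x_a)·ΔG₂(x_b)·(curv r) a b x` — g55 PART 7's adjointness with the weighted wedge
(PART 7 = both weights the exit indicators: the curl over the block-EDGE plaquettes). -/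
theorem tsum_sum_mul_coordCharge_wilsonA_eq_neg_tsum (G₁ G₂ : ℤ → ℝ) {a b : Fin (d + 1)} (hab : a ≠ b) {D₁ D₂ : ℝ} (h₁ : ∀ t, |G₁ (t + 1) - G₁ t| ≤ D₁)
    (h₂ : ∀ t, |G₂ (t + 1) - G₂ t| ≤ D₂) {r : Form1 (d + 1) ℝ} (hr : ∀ κ, Summable fun u => |r κ u|) :
    ∑' u, ∑ κ', r κ' u * (∑' z, (G₂ (z b + 1) - G₂ (z b)) * ∑' x, (G₁ (x a + 1) - G₁ (x a)) * wilsonA d κ' u x z (Sum.inl a) (Sum.inl b))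
      = -∑' x, ((G₁ (x a + 1) - G₁ (x a)) * (G₂ (x b + 1) - G₂ (x b))) * curv r a b x :=
  tsum_sum_mul_eq_neg_tsum_of_quarter (fun κ' u => tsum_coordWt_tsum_coordWt_wilsonA G₁ G₂ κ' u a b)
    (abs_curv_pairForm_coord_le G₁ G₂ hab h₁ h₂)
    (fun x => by
      simp only [curv_pairForm_coord G₁ G₂ hab]
      exact sum_sum_curv_mul_wedge r a b _ x) hr

/-- [folklore] **EVERY WEIGHT ON `ℤ` HAS A PRIMITIVE**: for `f : ℤ → ℝ` there is `F` with `F(t+1) − F(t) = f(t)` for all `t` (`F t = Σ_{0≤i<t} f i` for `t ≥ 0`, `−Σ_{t≤i<0} f i`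
for `t < 0`) — so the single-channel weights of §2 are ALL weights `g(x_a)`. -/
theorem exists_forwardDiff_eq (f : ℤ → ℝ) : ∃ F : ℤ → ℝ, ∀ t : ℤ, F (t + 1) - F t = f t := by
  refine ⟨fun t => (∑ i ∈ Finset.range t.toNat, f i) - ∑ i ∈ Finset.range (-t).toNat, f (-1 - i), fun t => ?_⟩
  by_cases ht : 0 ≤ t
  · have h1 : (t + 1).toNat = t.toNat + 1 := by omega
    have h2 : (-(t + 1)).toNat = 0 := by omega
    have h3 : (-t).toNat = 0 := by omega
    have h4 : ((t.toNat : ℕ) : ℤ) = t := by omega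
    simp only [h1, h2, h3, Finset.sum_range_succ, Finset.sum_range_zero, h4]
    ring
  · have h1 : (t + 1).toNat = 0 := by omega
    have h2 : t.toNat = 0 := by omega
    have h3 : (-t).toNat = (-(t + 1)).toNat + 1 := by omega
    have h4 : (((-(t + 1)).toNat : ℕ) : ℤ) = -(t + 1) := by omega
    simp only [h1, h2, h3, Finset.sum_range_succ, Finset.sum_range_zero, h4]
    have : (-1 : ℤ) - -(t + 1) = t := by ring
    rw [this]
    ring

/-- [folklore] **BLOCK-CONSTANT COORDINATE POTENTIALS GIVE THE CLASS-𝒟 WEIGHTS** (`1 ≤ L`): for `G = F ∘ (⌊·∕L⌋)`,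
`G(t+1) − G(t) = 𝟙[t % L = L−1]·(F(⌊t∕L⌋ + 1) − F(⌊t∕L⌋))` — the exit indicator times the coarse difference read on the block label (PART 6 ∕ PART 2 are `F = id`). -/
theorem blockPot_forwardDiff {L : ℕ} (hL : 1 ≤ L) (F : ℤ → ℝ) (t : ℤ) :
    F ((t + 1) / (L : ℤ)) - F (t / (L : ℤ)) = (if t % (L : ℤ) = (L : ℤ) - 1 then (1 : ℝ) else 0) * (F (t / (L : ℤ) + 1) - F (t / (L : ℤ))) := by
  rw [int_ediv_add_one hL]
  split_ifs with h
  · rw [one_mul]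
  · rw [add_zero, sub_self, zero_mul]

end Summit.QuantumFields.BalabanUV.Beta.GAN24.WilsonPairFormCharge

end
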